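import Summits.QuantumFields.YangMills.Theorems.FluctuationComparisonRegPrIntLLargeFieldGasSocketOfEngine
import Summits.QuantumFields.YangMills.Theorems.FluctuationComparisonRegPrIntLLargeFieldGasInteriorDoor
import Summits.QuantumFields.YangMills.Theorems.FluctuationComparisonRegPrIntLLargeFieldGasBudgetSmall
import HarnessLib

/-!
# LFG^{can}∘ FROM ONE ENGINE PACKAGE (G9): ★★★ `canInt_of_enginePackage` ∕ ★★★ `largeFieldFourPtIntCan_of_enginePackage` — the WHOLE PREFIX of LFG^{can}∘ (`∀ L ∃ c₀ ∀ c ∃ pS ∀ b₀ p₀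
# ∃ γ₁ ∃ κ ∀ F γ ∃ Ψ ∀ J K …`) ASSEMBLED over FILE 9's per-`(J, K)` socket, so that the REGISTERED `stub_largeFieldFourPtIntCan` rests on ONE ∀∃-statement in print's letters:
# «for every block size `L` there are a grain `μ`, a small-factor constant `a > 0` and thresholds such that Bałaban's expansion with holes holds at every `(J, K)` with tree decay
# `≥ 4 + 2·log 26` per block» — ★p1's «exact gap list» for the large-field half of [Balaban1985UV3] Thm 1 at this stub, as ONE typed hypothesis

Cell `ym3-torus` (HUMAN RULING D-0037: rung R3 = continuum `SU(2)` Yang–Mills on `T³` — NOT `d = 4`, NOT infinite volume, NOT a mass gap, NOT the Clay problem); width seat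
`ym3-torus-px10` (gen 17), FILE 10 of the px10 LFG lineage; helper of the crux `stmt-QuantumFields-20520` `UnitScaleTilt.FluctuationComparisonRegPrIntL` (`--supports … --as
helper`, NOT a proof of it).  THEOREMS ONLY: 0 `def`, 0 `instance`, 0 `notation`, 0 `sorry`, default heartbeats.

THE ENGINE PACKAGE (hypothesis `hE`, spelled inline).  For every `L`: a grain `μ` (Bałaban's `M = L^μ`), a small-factor constant `a > 0` (per large plaquette at height `i` the factor
`e^{−a·p(g_i)²}`, ✓`smallFactor`), a window shrink `c₀ ∈ (0, 1]`; for every `c ∈ (0, c₀]` a profile threshold `pS`; for every `b₀ > 0`, `p₀ ≥ pS`, `p₀ > 0` a coupling ceiling `γE > 0`;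
and then for EVERY family `F` with `F.L = L`, every `γ ∈ (0, γE]`, every `J ≤ K`, given the rows (r1∘) and the two positivities of LFG^{can}∘'s prefix: a grain `μ′ ≤ μ`, `μ′ ≤ m + J`
(on a torus smaller than one `M`-cube the engine may coarsen to the whole-torus grain), and the ENGINE ROWS of FILE 9 at grain `μ′` — footprint map `Adm`, activities `ζ` with majorant
`ζbar`, the a.e. ratio identity per deep history on the window `W_J^{c}`, continuity, V-locality, the energy bound with `sf = smallFactor L γ b₀ p₀ a`, and tree decay per block
`κμ ≥ 4 + 2·log 26` (a PURE NUMBER: FILE 10 chooses the Kotecký–Preiss rate `κ := (6L^μ)⁻¹` and the coupling ceiling so small that the located budget satisfies `Ψ J·(3L^{3μ} + 1) ≤ 1`).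
* §1 `smallFactor_rescale` — `smallFactor L γ b₀ p₀ a = smallFactor L γ 1 p₀ (a·b₀²)` (the profile is linear in `b₀`), so px10 g16's budgets (stated for `b₀ ≥ 1`) serve every `b₀ > 0`;
  ★`exists_located_budget_blocks_small` — FILE 8's located block budget in ✓`…BudgetSmall.exists_deep_budget_small`'s quantifier order: `∀ ε > 0 ∃ γ₁ ∈ (0,1] ∀ γ ≤ γ₁ ∃ Ψ`,
  `0 ≤ Ψ J ≤ ε`, `J·Ψ J → 0`, and for every grain `μ′ ≤ μ` with `μ′ ≤ m + J`: `Σ_{l ∣ B^{μ′}(πsrc l) ∈ Fc} sf l ≤ Ψ J·|Fc|`.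
* §2 ★★★ `canInt_of_enginePackage` — ENGINE PACKAGE ⟹ the hypothesis `h` of px10 g16's ✓`…LargeFieldGasInteriorDoor.largeFieldFourPtIntCan_of_canInt` VERBATIM (the prefix threaded:
  `c₀ := c₀`, `pS := max pS 1`, `γ₁ := min γE γ_budget`, `κ := (6L^μ)⁻¹`, `Ψ :=` §1's; per `(J, K)`: FILE 9 ★★★`canIntBody_of_engine` at the engine's grain `μ′`).
* §3 ★★★ `largeFieldFourPtIntCan_of_enginePackage` — ∘ ✓`largeFieldFourPtIntCan_of_canInt`: ENGINE PACKAGE ⟹ the registered `LargeFieldFourPtIntCan` text (registry v11.4 :588,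
  δ-unfolded, as concluded by the interior door).  So `stub_largeFieldFourPtIntCan := largeFieldFourPtIntCan_of_enginePackage hE` for any proof `hE` of the package.

HONEST — WHAT THIS IS NOT.  Quantifier plumbing over FILES 7–9 and px10 g16's doors ∕ budgets; the ENGINE PACKAGE is Bałaban's large-field renormalisation operation for the `d = 3`
tower in identity form ([Balaban1985UV3] Thm 2 (43)–(47), (67)–(71); [Balaban1989LargeFieldII] (1.29)–(1.101)) — XL, OPEN, NOT proved here or anywhere in the tree.  CURRENCY CAVEAT
(px20 g15 `BLUEPRINT-ECE1` S7, LINE g24-4 BGFORM∘): the row `hloc` asks STRICT V-locality of the activities in the field `U`; print's localised terms are local in the BACKGROUND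
`U₀(U)|_X` ([Balaban1987RG1] (0.22)–(0.24)), so the package as typed = print's 𝐑-operation output PLUS a localisation of the background dependence — the socket's letter, inherited
verbatim from ✓`canIntBody_of_factorised_histories`, not decided here (a BGFORM∘ re-typing of the socket would replace `hloc` and the downstream four-point door).  LFG^{can}∘ ∕
`stub_largeFieldFourPtIntCan` ∕ S2β ∕ the crux 20520 NOT proved; `YM3TorusSU2` NOT proved; finite volume ∕ conditional; the Yang–Mills mass gap (Clay) NOT proved; rung R3 = YM₃ on
`T³` — NOT `d = 4`, NOT infinite volume, NOT a mass gap.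
References: [Balaban1985UV3] T. Bałaban, CMP 102 (1985): Thm 1 p.257, (39)–(47) pp.266–267, (67)–(71) pp.273–274; [Balaban1989LargeFieldII] CMP 122 (1989): (1.84) p.386,
(1.90)–(1.91) p.388, (1.97)–(1.101) pp.389–390; [Balaban1987RG1] CMP 109 (1987) (0.22)–(0.26) pp.256–257; [KoteckyPreiss1986] CMP 103 (1986), Theorem p.492 (1).
-/

set_option autoImplicit false

noncomputable section

open Finset MeasureTheory Filter Topology Set
open scoped BigOperators
open Literature.Probability.LatticeModels
open Literature.MathematicalPhysics.QuantumFieldTheory.Balaban1983to89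
open Literature.MathematicalPhysics.QuantumFieldTheory.Balaban1983to89.T3ContinuumYM3Torus
open Literature.MathematicalPhysics.QuantumFieldTheory.Balaban1983to89.T3NestedUnitLaws
open Literature.MathematicalPhysics.QuantumFieldTheory.Balaban1983to89.T3UnitLawDensityEML
open Literature.MathematicalPhysics.QuantumFieldTheory.Balaban1983to89.T3UnitScaleTilt
open Literature.MathematicalPhysics.QuantumFieldTheory.Balaban1983to89.T3TiltDescent
open Literature.MathematicalPhysics.QuantumFieldTheory.Balaban1983to89.T3PrintedRegularMinimiser
open Literature.MathematicalPhysics.QuantumFieldTheory.Balaban1983to89.T3LevelShift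
open Literature.MathematicalPhysics.QuantumFieldTheory.Balaban1983to89.Missing
open Literature.MathematicalPhysics.QuantumFieldTheory.Balaban1983to89.T4Continuum
open scoped Literature.MathematicalPhysics.QuantumFieldTheory.Balaban1983to89.T3OrbitAverage
open Literature.MathematicalPhysics.QuantumFieldTheory.Balaban1983to89.Node00 (touchingGraph SiteTouch)
open Literature.MathematicalPhysics.QuantumFieldTheory.Balaban1983to89.B5Eq118OneStroke (iterBlockOf iterBlock)
open Literature.MathematicalPhysics.QuantumFieldTheory.BalabanImbrieJaffe1984to88.BIJ85BlockAveragesTorusK (blkIter)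
open Summit.QuantumFields.YangMills.Theorems.FluctuationComparisonRegPrIntLWregGlue (heightDensityCan)
open Summit.QuantumFields.YangMills.Theorems.FluctuationComparisonRegPrIntLHistoryPartition (LFLabel histEvent smallFactor smallFactor_pos)
open Summit.QuantumFields.YangMills.Theorems.FluctuationComparisonRegPrIntLLargeFieldGasBudgetSmall (exists_deep_budget_small)
open Summit.QuantumFields.YangMills.Theorems.FluctuationComparisonRegPrIntLLargeFieldGasLabelCount (sum_sf_located_le sum_deep_reindex deep_heights_gt
  filter_blk_mem_eq card_biUnion_iterBlock)
open Summit.QuantumFields.YangMills.Theorems.FluctuationComparisonRegPrIntLLargeFieldGasSocketOfEngine (canIntBody_of_engine)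
open Summit.QuantumFields.YangMills.Theorems.FluctuationComparisonRegPrIntLLargeFieldGasInteriorDoor (largeFieldFourPtIntCan_of_canInt)

namespace Summit.QuantumFields.YangMills.Theorems.FluctuationComparisonRegPrIntLLargeFieldGasOfEnginePackage

/-! ## §1 The located block budget for every `b₀ > 0`, small below a coupling ceiling -/

/-- **THE PROFILE IS LINEAR IN `b₀`**: `e^{−a·p_{b₀}(g)²} = e^{−(a b₀²)·p_1(g)²}`, i.e. `smallFactor L γ b₀ p₀ a = smallFactor L γ 1 p₀ (a·b₀²)`. [cite: Balaban1985UV3, (7) p.257] -/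
theorem smallFactor_rescale (L : ℕ) (γ b₀ p₀ a : ℝ) (i : ℕ) : smallFactor L γ b₀ p₀ a i = smallFactor L γ 1 p₀ (a * b₀ ^ 2) i := by
  simp only [smallFactor, B10.pFun]
  ring_nf

open Classical in
/-- ★ **THE LOCATED BLOCK BUDGET, SMALL BELOW A COUPLING CEILING, EVERY `b₀ > 0`, EVERY GRAIN `μ′ ≤ μ`, IN THE PREFIX ORDER** (`γ₁` and `Ψ` depend on `L`, not on the family
`F`): FILE 8's located sums (`sum_sf_located_le`, `filter_blk_mem_eq`, `card_biUnion_iterBlock`) fed into ✓`exists_deep_budget_small` (with `c₀ := 9·L^{3μ}`, `b₀ := 1`,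
`κ := a·b₀²` via `smallFactor_rescale`). [cite: Balaban1985UV3, (41) p.266 and (67)-(71) pp.273-274; Balaban1989LargeFieldII, (1.100)-(1.101) p.390] -/
theorem exists_located_budget_blocks_small {L : ℕ} (hL : 1 < L) {b₀ p₀ a : ℝ} (hb : 0 < b₀) (hp : 1 ≤ p₀) (ha : 0 < a) (μ : ℕ) {ε : ℝ} (hε : 0 < ε) :
    ∃ γ₁ : ℝ, 0 < γ₁ ∧ γ₁ ≤ 1 ∧ ∀ γ : ℝ, 0 < γ → γ ≤ γ₁ →
      ∃ Ψ : ℕ → ℝ, (∀ J, 0 ≤ Ψ J) ∧ (∀ J, Ψ J ≤ ε) ∧ Tendsto (fun J : ℕ => (J : ℝ) * Ψ J) atTop (𝓝 0) ∧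
        ∀ (F : T3Family), F.L = L → ∀ (J K : ℕ) (hJK : J ≤ K) (μ' : ℕ), μ' ≤ μ → μ' ≤ F.m + J → ∀ Fc : Finset (Site (F.P J) μ'),
          ∑ l ∈ Finset.univ.filter (fun l : LFLabel F K J =>
              iterBlockOf μ' (siteShift (F.sitesPerDir_eq (m := F.m) (K := K) (j := l.1.val + (K - J - l.1.val)) (m' := F.m) (K' := J) (j' := 0)
                (by have := l.1.isLt; omega)) (blkIter (K - J - l.1.val) l.2.src)) ∈ Fc),
            (if l.1.val < K - J then smallFactor F.L γ b₀ p₀ a (K - l.1.val) else 0) ≤ Ψ J * (Fc.card : ℝ) := by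
  have hκ' : 0 < a * b₀ ^ 2 := by positivity
  have hc₀ : (0 : ℝ) ≤ 9 * ((L : ℝ) ^ 3) ^ μ := by positivity
  obtain ⟨γ₁, hγ₁, hγ₁1, H⟩ := exists_deep_budget_small hL (le_refl (1 : ℝ)) hp hκ' hc₀ hε
  refine ⟨γ₁, hγ₁, hγ₁1, fun γ hγ hγle => ?_⟩
  obtain ⟨Ψ, hΨ0, hΨε, hΨt, hΨ⟩ := H γ hγ hγle
  refine ⟨Ψ, hΨ0, hΨε, hΨt, fun F hFL J K hJK μ' hμ'μ hμ' Fc => ?_⟩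
  subst hFL
  have hL1 : (1 : ℝ) ≤ F.L := by exact_mod_cast hL.le
  -- rescale the profile to `b₀ = 1`
  have hresc : ∀ l : LFLabel F K J, (if l.1.val < K - J then smallFactor F.L γ b₀ p₀ a (K - l.1.val) else 0) =
      (if l.1.val < K - J then smallFactor F.L γ 1 p₀ (a * b₀ ^ 2) (K - l.1.val) else 0) := by
    intro l
    split_ifs
    · exact smallFactor_rescale _ _ _ _ _ _
    · rfl
  rw [Finset.sum_congr rfl (fun l _ => hresc l), filter_blk_mem_eq F hJK μ' Fc]
  have h1 := sum_sf_located_le F γ 1 p₀ (a * b₀ ^ 2) hJK (Fc.biUnion (iterBlock μ'))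
  rw [card_biUnion_iterBlock F hμ' Fc, sum_deep_reindex F γ 1 p₀ (a * b₀ ^ 2)] at h1
  have h2 := hΨ J _ (deep_heights_gt (J := J) (K := K))
  -- `|Fc|·L^{3μ′} · Σ 9·(…) ≤ |Fc| · Σ (9 L^{3μ})·(…) ≤ |Fc| · Ψ J`
  have hS0 : 0 ≤ ∑ i ∈ (Finset.range (K - J)).image (fun j => K - j), 9 * (F.L : ℝ) ^ (3 * (i - J)) * smallFactor F.L γ 1 p₀ (a * b₀ ^ 2) i :=
    Finset.sum_nonneg fun i _ => by have := (smallFactor_pos F.L γ 1 p₀ (a * b₀ ^ 2) i).le; positivity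
  have hpow' : ((F.L : ℝ) ^ 3) ^ μ' ≤ ((F.L : ℝ) ^ 3) ^ μ := pow_le_pow_right₀ (one_le_pow₀ hL1) hμ'μ
  have hmul : ∑ i ∈ (Finset.range (K - J)).image (fun j => K - j), 9 * ((F.L : ℝ) ^ 3) ^ μ * (F.L : ℝ) ^ (3 * (i - J)) * smallFactor F.L γ 1 p₀ (a * b₀ ^ 2) i =
      ((F.L : ℝ) ^ 3) ^ μ * ∑ i ∈ (Finset.range (K - J)).image (fun j => K - j), 9 * (F.L : ℝ) ^ (3 * (i - J)) * smallFactor F.L γ 1 p₀ (a * b₀ ^ 2) i := by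
    rw [Finset.mul_sum]
    exact Finset.sum_congr rfl fun i _ => by ring
  rw [hmul] at h2
  calc _ ≤ ((Fc.card * (F.L ^ 3) ^ μ' : ℕ) : ℝ) *
        ∑ i ∈ (Finset.range (K - J)).image (fun j => K - j), 9 * (F.L : ℝ) ^ (3 * (i - J)) * smallFactor F.L γ 1 p₀ (a * b₀ ^ 2) i := h1
    _ ≤ (Fc.card : ℝ) * (((F.L : ℝ) ^ 3) ^ μ *
        ∑ i ∈ (Finset.range (K - J)).image (fun j => K - j), 9 * (F.L : ℝ) ^ (3 * (i - J)) * smallFactor F.L γ 1 p₀ (a * b₀ ^ 2) i) := by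
        push_cast
        rw [mul_assoc]
        exact mul_le_mul_of_nonneg_left (mul_le_mul_of_nonneg_right hpow' hS0) (Nat.cast_nonneg _)
    _ ≤ (Fc.card : ℝ) * Ψ J := mul_le_mul_of_nonneg_left h2 (Nat.cast_nonneg _)
    _ = Ψ J * (Fc.card : ℝ) := mul_comm _ _


/-! ## §2 The prefix of LFG^{can}∘ assembled over FILE 9 -/

open Classical in
/-- ★★★ **LFG^{can}∘ FROM THE ENGINE PACKAGE** — the hypothesis `h` of px10 g16's ✓`largeFieldFourPtIntCan_of_canInt` (the interior canonical large-field gas identity with its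
whole prefix `∀ L ∃ c₀ ∀ c ∃ pS ∀ b₀ p₀ ∃ γ₁ ∃ κ ∀ F γ ∃ Ψ ∀ J K`), from ONE package of ENGINE ROWS: per `(J, K)` FILE 9 ★★★`canIntBody_of_engine` at the engine's grain `μ′ ≤ μ`, with
`pS ↦ max pS 1`, `γ₁ := min γE γ_budget` (§1 with `ε := (3L^{3μ} + 1)⁻¹`), Kotecký–Preiss rate `κ := (6L^μ)⁻¹`, and `Ψ :=` §1's located block budget, so that FILE 9's rate row
`Ψ J·3L^{3μ′} + κ·6L^{μ′} + 2 log 26 + Ψ J + 2 ≤ κμ` follows from the package's pure number `4 + 2 log 26 ≤ κμ`.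
[cite: Balaban1985UV3, (43)-(47) pp.266-267 and (67)-(71) pp.273-274; Balaban1989LargeFieldII, (1.84) p.386, (1.90)-(1.91) p.388 and (1.97)-(1.101) pp.389-390; KoteckyPreiss1986, Theorem p.492 (1)] -/
theorem canInt_of_enginePackage
    (hE : ∀ (L : ℕ), ∃ μ : ℕ, ∃ a : ℝ, 0 < a ∧ ∃ c₀ : ℝ, 0 < c₀ ∧ c₀ ≤ 1 ∧ ∀ (c : ℝ), 0 < c → c ≤ c₀ → ∃ pS : ℝ, ∀ (b₀ p₀ : ℝ), 0 < b₀ → pS ≤ p₀ → 0 < p₀ →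
      ∃ γE : ℝ, 0 < γE ∧ ∀ (F : T3Family) (γ : ℝ), F.L = L → 0 < γ → γ ≤ γE →
        ∀ (J K : ℕ) (hJK : J ≤ K),
          {U : GaugeField (F.P J) 0 (Matrix.specialUnitaryGroup (Fin 2) ℂ) | PlaqSmall (θBal F.L γ (c * b₀) p₀ J) U} ⊆
            Node00.regSet (fieldMeasure (F.P J) 0 (Matrix.specialUnitaryGroup (Fin 2) ℂ)) (heightDensity F γ hJK Set.univ) →
          (∀ U : GaugeField (F.P J) 0 (Matrix.specialUnitaryGroup (Fin 2) ℂ), PlaqSmall (θBal F.L γ (c * b₀) p₀ J) U →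
              0 < heightDensityCan F γ hJK Set.univ U) →
          (∀ U : GaugeField (F.P J) 0 (Matrix.specialUnitaryGroup (Fin 2) ℂ), PlaqSmall (θBal F.L γ (c * b₀) p₀ J) U →
              0 < heightDensityCan F γ hJK (histGood F ℰp (θBal F.L γ b₀ p₀) K J) U) →
          -- ═══ the engine's output at `(J, K)`: a grain and Bałaban's expansion with holes ═══
          ∃ μ' : ℕ, μ' ≤ μ ∧ μ' ≤ F.m + J ∧
          ∃ (Adm : Finset (LFLabel F K J) → Finset (PBond (F.P J) 0) → Prop)
            (ζ : Finset (LFLabel F K J) → Finset (PBond (F.P J) 0) → GaugeField (F.P J) 0 (Matrix.specialUnitaryGroup (Fin 2) ℂ) → ℝ)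
            (ζbar : Finset (LFLabel F K J) → Finset (PBond (F.P J) 0) → ℝ) (κmu : ℝ),
            -- footprint map
            (∀ Q' X, Adm Q' X → Q'.Nonempty ∧
              (∀ l ∈ Q', l.1.val < K - J ∧
              (⟨siteShift (F.sitesPerDir_eq (m := F.m) (K := K) (j := l.1.val + (K - J - l.1.val)) (m' := F.m) (K' := J) (j' := 0)
              (by have := l.1.isLt; omega)) (blkIter (K - J - l.1.val) l.2.src), l.2.μ⟩ : PBond (F.P J) 0) ∈ X) ∧
              ∃ Fc : Finset (Site (F.P J) μ'), ((touchingGraph (SiteTouch (P := F.P J) (j := μ'))).induce (Fc : Set (Site (F.P J) μ'))).Connected ∧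
              Fc.biUnion (fun y => Finset.univ.filter (fun b : PBond (F.P J) 0 => iterBlockOf μ' b.src = y)) = X) ∧
            -- the a.e. ratio identity of the expansion with holes, per deep history, on the window
            (∀ Q : Finset (LFLabel F K J), (∀ l ∈ Q, l.1.val < K - J) →
              ∀ᵐ U ∂fieldMeasure (F.P J) 0 (Matrix.specialUnitaryGroup (Fin 2) ℂ), PlaqSmall (θBal F.L γ (c * b₀) p₀ J) U →
              heightDensity F γ hJK (histEvent F (θBal F.L γ b₀ p₀) K J Q) U =
              heightDensity F γ hJK (histGood F ℰp (θBal F.L γ b₀ p₀) K J) U *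
              ∑ 𝒳 ∈ (Finset.univ : Finset (Finset (PBond (F.P J) 0))).powerset.filter (fun 𝒳 => IsCompatible polyInc 𝒳 ∧
              (∀ l ∈ Q, ∃ X ∈ 𝒳, (⟨siteShift (F.sitesPerDir_eq (m := F.m) (K := K) (j := l.1.val + (K - J - l.1.val)) (m' := F.m) (K' := J)
              (j' := 0) (by have := l.1.isLt; omega)) (blkIter (K - J - l.1.val) l.2.src), l.2.μ⟩ : PBond (F.P J) 0) ∈ X) ∧
              ∀ X ∈ 𝒳, Adm (Q.filter fun l => (⟨siteShift (F.sitesPerDir_eq (m := F.m) (K := K) (j := l.1.val + (K - J - l.1.val))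
              (m' := F.m) (K' := J) (j' := 0) (by have := l.1.isLt; omega)) (blkIter (K - J - l.1.val) l.2.src), l.2.μ⟩ : PBond (F.P J) 0) ∈ X) X),
              ∏ X ∈ 𝒳, ζ (Q.filter fun l => (⟨siteShift (F.sitesPerDir_eq (m := F.m) (K := K) (j := l.1.val + (K - J - l.1.val))
              (m' := F.m) (K' := J) (j' := 0) (by have := l.1.isLt; omega)) (blkIter (K - J - l.1.val) l.2.src), l.2.μ⟩ : PBond (F.P J) 0) ∈ X) X U) ∧
            -- continuous, V-local activities with a window-uniform majorant
            (∀ Q' X, Adm Q' X → ContinuousOn (fun U => ζ Q' X U)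
              {U : GaugeField (F.P J) 0 (Matrix.specialUnitaryGroup (Fin 2) ℂ) | PlaqSmall (θBal F.L γ (c * b₀) p₀ J) U}) ∧
            (∀ Q' X (U U' : GaugeField (F.P J) 0 (Matrix.specialUnitaryGroup (Fin 2) ℂ)), Adm Q' X → (∀ e ∈ X, U e = U' e) → ζ Q' X U = ζ Q' X U') ∧
            (∀ Q' X U, Adm Q' X → PlaqSmall (θBal F.L γ (c * b₀) p₀ J) U → |ζ Q' X U| ≤ ζbar Q' X) ∧
            (∀ Q' X, Adm Q' X → 0 ≤ ζbar Q' X) ∧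
            -- the energy bound: one small factor per hole, tree decay per block
            (∀ Q' X, Adm Q' X → ζbar Q' X ≤
              (∏ l ∈ Q', (if l.1.val < K - J then smallFactor F.L γ b₀ p₀ a (K - l.1.val) else 0)) *
              Real.exp (-(κmu * ((X.image (fun b : PBond (F.P J) 0 => iterBlockOf μ' b.src)).card : ℝ)))) ∧
            -- tree decay per block beats the entropy of block animals (a pure number)
            4 + 2 * Real.log 26 ≤ κmu) :
    ∀ (L : ℕ), ∃ c₀ : ℝ, 0 < c₀ ∧ c₀ ≤ 1 ∧ ∀ (c : ℝ), 0 < c → c ≤ c₀ → ∃ pS : ℝ, ∀ (b₀ p₀ : ℝ), 0 < b₀ → pS ≤ p₀ → 0 < p₀ →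
      ∃ γ₁ : ℝ, 0 < γ₁ ∧ ∃ κ : ℝ, 0 < κ ∧ ∀ (F : T3Family) (γ : ℝ), F.L = L → 0 < γ → γ ≤ γ₁ →
        ∃ Ψ : ℕ → ℝ, (∀ J, 0 ≤ Ψ J) ∧ Tendsto (fun J : ℕ => (J : ℝ) * Ψ J) atTop (𝓝 0) ∧
          ∀ (J K : ℕ) (hJK : J ≤ K),
            {U : GaugeField (F.P J) 0 (Matrix.specialUnitaryGroup (Fin 2) ℂ) | PlaqSmall (θBal F.L γ (c * b₀) p₀ J) U} ⊆
              Node00.regSet (fieldMeasure (F.P J) 0 (Matrix.specialUnitaryGroup (Fin 2) ℂ)) (heightDensity F γ hJK Set.univ) →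
            (∀ U : GaugeField (F.P J) 0 (Matrix.specialUnitaryGroup (Fin 2) ℂ), PlaqSmall (θBal F.L γ (c * b₀) p₀ J) U →
                0 < heightDensityCan F γ hJK Set.univ U) →
            (∀ U : GaugeField (F.P J) 0 (Matrix.specialUnitaryGroup (Fin 2) ℂ), PlaqSmall (θBal F.L γ (c * b₀) p₀ J) U →
                0 < heightDensityCan F γ hJK (histGood F ℰp (θBal F.L γ b₀ p₀) K J) U) →
            ∃ (cst : ℝ) (w : GaugeField (F.P J) 0 (Matrix.specialUnitaryGroup (Fin 2) ℂ) → Finset (PBond (F.P J) 0) → ℝ),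
              (∃ (wbar a ℓ : Finset (PBond (F.P J) 0) → ℝ),
                (∀ U, w U ∅ = 0) ∧
                (∀ (X : Finset (PBond (F.P J) 0)) (U U' : GaugeField (F.P J) 0 (Matrix.specialUnitaryGroup (Fin 2) ℂ)),
                  (∀ e ∈ X, U e = U' e) → w U X = w U' X) ∧
                (∀ X, 0 ≤ a X) ∧ (∀ X, 0 ≤ ℓ X) ∧
                (∀ U, U ∈ {U : GaugeField (F.P J) 0 (Matrix.specialUnitaryGroup (Fin 2) ℂ) | PlaqSmall (θBal F.L γ (c * b₀) p₀ J) U} →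
                  ∀ X, |w U X| ≤ wbar X) ∧
                (∀ X : Finset (PBond (F.P J) 0), ∀ e ∈ X, ∀ e' ∈ X, (e.src.tdist e'.src : ℝ) ≤ ℓ X) ∧
                (∀ X : Finset (PBond (F.P J) 0), ∑ X' ∈ Finset.univ.filter (fun X' => polyInc X' X),
                    wbar X' * Real.exp (a X' + κ * ℓ X') ≤ a X) ∧
                (∀ e : PBond (F.P J) 0, a {e} ≤ Ψ J)) ∧
              ∀ U : GaugeField (F.P J) 0 (Matrix.specialUnitaryGroup (Fin 2) ℂ), PlaqSmall (θBal F.L γ (c * b₀) p₀ J) U →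
                heightDensityCan F γ hJK Set.univ U =
                  Real.exp cst * heightDensityCan F γ hJK (histGood F ℰp (θBal F.L γ b₀ p₀) K J) U *
                    (polymerPartitionFunction polyInc (fun X : Finset (PBond (F.P J) 0) => ((w U X : ℝ) : ℂ)) Finset.univ).re := by
  intro L
  obtain ⟨μ, a, ha, c₀, hc₀, hc₀1, HE⟩ := hE L
  refine ⟨c₀, hc₀, hc₀1, fun c hc hcc₀ => ?_⟩
  obtain ⟨pS, HE⟩ := HE c hc hcc₀
  refine ⟨max pS 1, fun b₀ p₀ hb hpS hp => ?_⟩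
  have hp1 : 1 ≤ p₀ := (le_max_right pS 1).trans hpS
  obtain ⟨γE, hγE, HE⟩ := HE b₀ p₀ hb ((le_max_left pS 1).trans hpS) hp
  by_cases hL : 1 < L
  · -- the honest case: block size `L > 1`
    have hL1 : (1 : ℝ) ≤ L := by exact_mod_cast hL.le
    have hLμ : (0 : ℝ) < 6 * (L : ℝ) ^ μ := by positivity
    have hS : (0 : ℝ) < 3 * ((L : ℝ) ^ 3) ^ μ + 1 := by positivity
    obtain ⟨γB, hγB, hγB1, HB⟩ := exists_located_budget_blocks_small hL hb hp1 ha μ (ε := (3 * ((L : ℝ) ^ 3) ^ μ + 1)⁻¹) (inv_pos.mpr hS)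
    refine ⟨min γE γB, lt_min hγE hγB, (6 * (L : ℝ) ^ μ)⁻¹, inv_pos.mpr hLμ, fun F γ hFL hγ hγle => ?_⟩
    obtain ⟨Ψ, hΨ0, hΨε, hΨt, HΨ⟩ := HB γ hγ (hγle.trans (min_le_right _ _))
    refine ⟨Ψ, hΨ0, hΨt, fun J K hJK hR hP₁ hP₂ => ?_⟩
    obtain ⟨μ', hμ'μ, hμ'J, Adm, ζ, ζbar, κmu, hAdm, hrat, hζc, hloc, hdom, hζ0, hζ, hrate⟩ :=
      HE F γ hFL hγ (hγle.trans (min_le_left _ _)) J K hJK hR hP₁ hP₂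
    have hγ1 : γ ≤ 1 := hγle.trans ((min_le_right _ _).trans hγB1)
    -- the rate row of FILE 9 from the pure number `4 + 2 log 26 ≤ κμ`
    have hrow : Ψ J * (3 * ((F.L : ℝ) ^ 3) ^ μ') + (6 * (L : ℝ) ^ μ)⁻¹ * (6 * (F.L : ℝ) ^ μ') + 2 * Real.log 26 + Ψ J + 2 ≤ κmu := by
      rw [hFL]
      have hA : ((L : ℝ) ^ 3) ^ μ' ≤ ((L : ℝ) ^ 3) ^ μ := pow_le_pow_right₀ (one_le_pow₀ hL1) hμ'μ
      have hB : (6 * (L : ℝ) ^ μ)⁻¹ * (6 * (L : ℝ) ^ μ') ≤ 1 := by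
        have h6 : 6 * (L : ℝ) ^ μ' ≤ 6 * (L : ℝ) ^ μ := by
          have := pow_le_pow_right₀ hL1 hμ'μ
          linarith
        calc (6 * (L : ℝ) ^ μ)⁻¹ * (6 * (L : ℝ) ^ μ') ≤ (6 * (L : ℝ) ^ μ)⁻¹ * (6 * (L : ℝ) ^ μ) :=
              mul_le_mul_of_nonneg_left h6 (inv_pos.mpr hLμ).le
          _ = 1 := inv_mul_cancel₀ hLμ.ne'
      have hC : Ψ J * (3 * ((L : ℝ) ^ 3) ^ μ') + Ψ J ≤ 1 := by
        have h1 : Ψ J * (3 * ((L : ℝ) ^ 3) ^ μ') + Ψ J ≤ Ψ J * (3 * ((L : ℝ) ^ 3) ^ μ + 1) := by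
          have := mul_le_mul_of_nonneg_left hA (hΨ0 J)
          nlinarith
        have h2 : Ψ J * (3 * ((L : ℝ) ^ 3) ^ μ + 1) ≤ (3 * ((L : ℝ) ^ 3) ^ μ + 1)⁻¹ * (3 * ((L : ℝ) ^ 3) ^ μ + 1) :=
          mul_le_mul_of_nonneg_right (hΨε J) hS.le
        rw [inv_mul_cancel₀ hS.ne'] at h2
        linarith
      linarith
    exact canIntBody_of_engine F hγ hγ1 hb p₀ (hcc₀.trans hc₀1) hJK (inv_pos.mpr hLμ).le Ψ (hΨ0 J) a μ' hμ'J
      (HΨ F hFL J K hJK μ' hμ'μ hμ'J) hR Adm hAdm ζ ζbar κmu hrat hζc hloc hdom hζ0 hζ hrow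
  · -- no `T3Family` has block size `≤ 1`: the family clause is vacuous
    exact ⟨1, one_pos, 1, one_pos, fun F γ hFL _ _ => absurd (hFL ▸ F.hL.2) hL⟩

/-! ## §3 The registered stub from the engine package -/

open Classical in
/-- ★★★ **THE REGISTERED `LargeFieldFourPtIntCan` (registry v11.4 :588, δ-unfolded, as concluded by px10 g16's interior door) FROM THE ENGINE PACKAGE**:
`largeFieldFourPtIntCan_of_canInt ∘ canInt_of_enginePackage`.  So `stub_largeFieldFourPtIntCan := largeFieldFourPtIntCan_of_enginePackage hE` for any proof `hE` of the package —
the large-field half of [Balaban1985UV3] Thm 1 at this stub rests on ONE typed hypothesis. [cite: Balaban1985UV3, Thm 1 p.257 and (43)-(47) pp.266-267; Balaban1989LargeFieldII, (1.90) p.388 and (1.97)-(1.101) pp.389-390; Balaban1988Convergent, §2 (2.18)-(2.27)] -/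
theorem largeFieldFourPtIntCan_of_enginePackage
    (hE : ∀ (L : ℕ), ∃ μ : ℕ, ∃ a : ℝ, 0 < a ∧ ∃ c₀ : ℝ, 0 < c₀ ∧ c₀ ≤ 1 ∧ ∀ (c : ℝ), 0 < c → c ≤ c₀ → ∃ pS : ℝ, ∀ (b₀ p₀ : ℝ), 0 < b₀ → pS ≤ p₀ → 0 < p₀ →
      ∃ γE : ℝ, 0 < γE ∧ ∀ (F : T3Family) (γ : ℝ), F.L = L → 0 < γ → γ ≤ γE →
        ∀ (J K : ℕ) (hJK : J ≤ K),
          {U : GaugeField (F.P J) 0 (Matrix.specialUnitaryGroup (Fin 2) ℂ) | PlaqSmall (θBal F.L γ (c * b₀) p₀ J) U} ⊆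
            Node00.regSet (fieldMeasure (F.P J) 0 (Matrix.specialUnitaryGroup (Fin 2) ℂ)) (heightDensity F γ hJK Set.univ) →
          (∀ U : GaugeField (F.P J) 0 (Matrix.specialUnitaryGroup (Fin 2) ℂ), PlaqSmall (θBal F.L γ (c * b₀) p₀ J) U →
              0 < heightDensityCan F γ hJK Set.univ U) →
          (∀ U : GaugeField (F.P J) 0 (Matrix.specialUnitaryGroup (Fin 2) ℂ), PlaqSmall (θBal F.L γ (c * b₀) p₀ J) U →
              0 < heightDensityCan F γ hJK (histGood F ℰp (θBal F.L γ b₀ p₀) K J) U) →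
          -- ═══ the engine's output at `(J, K)`: a grain and Bałaban's expansion with holes ═══
          ∃ μ' : ℕ, μ' ≤ μ ∧ μ' ≤ F.m + J ∧
          ∃ (Adm : Finset (LFLabel F K J) → Finset (PBond (F.P J) 0) → Prop)
            (ζ : Finset (LFLabel F K J) → Finset (PBond (F.P J) 0) → GaugeField (F.P J) 0 (Matrix.specialUnitaryGroup (Fin 2) ℂ) → ℝ)
            (ζbar : Finset (LFLabel F K J) → Finset (PBond (F.P J) 0) → ℝ) (κmu : ℝ),
            -- footprint map
            (∀ Q' X, Adm Q' X → Q'.Nonempty ∧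
              (∀ l ∈ Q', l.1.val < K - J ∧
              (⟨siteShift (F.sitesPerDir_eq (m := F.m) (K := K) (j := l.1.val + (K - J - l.1.val)) (m' := F.m) (K' := J) (j' := 0)
              (by have := l.1.isLt; omega)) (blkIter (K - J - l.1.val) l.2.src), l.2.μ⟩ : PBond (F.P J) 0) ∈ X) ∧
              ∃ Fc : Finset (Site (F.P J) μ'), ((touchingGraph (SiteTouch (P := F.P J) (j := μ'))).induce (Fc : Set (Site (F.P J) μ'))).Connected ∧
              Fc.biUnion (fun y => Finset.univ.filter (fun b : PBond (F.P J) 0 => iterBlockOf μ' b.src = y)) = X) ∧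
            -- the a.e. ratio identity of the expansion with holes, per deep history, on the window
            (∀ Q : Finset (LFLabel F K J), (∀ l ∈ Q, l.1.val < K - J) →
              ∀ᵐ U ∂fieldMeasure (F.P J) 0 (Matrix.specialUnitaryGroup (Fin 2) ℂ), PlaqSmall (θBal F.L γ (c * b₀) p₀ J) U →
              heightDensity F γ hJK (histEvent F (θBal F.L γ b₀ p₀) K J Q) U =
              heightDensity F γ hJK (histGood F ℰp (θBal F.L γ b₀ p₀) K J) U *
              ∑ 𝒳 ∈ (Finset.univ : Finset (Finset (PBond (F.P J) 0))).powerset.filter (fun 𝒳 => IsCompatible polyInc 𝒳 ∧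
              (∀ l ∈ Q, ∃ X ∈ 𝒳, (⟨siteShift (F.sitesPerDir_eq (m := F.m) (K := K) (j := l.1.val + (K - J - l.1.val)) (m' := F.m) (K' := J)
              (j' := 0) (by have := l.1.isLt; omega)) (blkIter (K - J - l.1.val) l.2.src), l.2.μ⟩ : PBond (F.P J) 0) ∈ X) ∧
              ∀ X ∈ 𝒳, Adm (Q.filter fun l => (⟨siteShift (F.sitesPerDir_eq (m := F.m) (K := K) (j := l.1.val + (K - J - l.1.val))
              (m' := F.m) (K' := J) (j' := 0) (by have := l.1.isLt; omega)) (blkIter (K - J - l.1.val) l.2.src), l.2.μ⟩ : PBond (F.P J) 0) ∈ X) X),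
              ∏ X ∈ 𝒳, ζ (Q.filter fun l => (⟨siteShift (F.sitesPerDir_eq (m := F.m) (K := K) (j := l.1.val + (K - J - l.1.val))
              (m' := F.m) (K' := J) (j' := 0) (by have := l.1.isLt; omega)) (blkIter (K - J - l.1.val) l.2.src), l.2.μ⟩ : PBond (F.P J) 0) ∈ X) X U) ∧
            -- continuous, V-local activities with a window-uniform majorant
            (∀ Q' X, Adm Q' X → ContinuousOn (fun U => ζ Q' X U)
              {U : GaugeField (F.P J) 0 (Matrix.specialUnitaryGroup (Fin 2) ℂ) | PlaqSmall (θBal F.L γ (c * b₀) p₀ J) U}) ∧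
            (∀ Q' X (U U' : GaugeField (F.P J) 0 (Matrix.specialUnitaryGroup (Fin 2) ℂ)), Adm Q' X → (∀ e ∈ X, U e = U' e) → ζ Q' X U = ζ Q' X U') ∧
            (∀ Q' X U, Adm Q' X → PlaqSmall (θBal F.L γ (c * b₀) p₀ J) U → |ζ Q' X U| ≤ ζbar Q' X) ∧
            (∀ Q' X, Adm Q' X → 0 ≤ ζbar Q' X) ∧
            -- the energy bound: one small factor per hole, tree decay per block
            (∀ Q' X, Adm Q' X → ζbar Q' X ≤
              (∏ l ∈ Q', (if l.1.val < K - J then smallFactor F.L γ b₀ p₀ a (K - l.1.val) else 0)) *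
              Real.exp (-(κmu * ((X.image (fun b : PBond (F.P J) 0 => iterBlockOf μ' b.src)).card : ℝ)))) ∧
            -- tree decay per block beats the entropy of block animals (a pure number)
            4 + 2 * Real.log 26 ≤ κmu) :
    ∀ (L : ℕ), ∃ c₀ : ℝ, 0 < c₀ ∧ c₀ ≤ 1 ∧ ∀ (c : ℝ), 0 < c → c ≤ c₀ → ∃ pS : ℝ, ∀ (b₀ p₀ : ℝ), 0 < b₀ → pS ≤ p₀ → 0 < p₀ →
      ∃ γ₁ : ℝ, 0 < γ₁ ∧ ∃ κ : ℝ, 0 < κ ∧ ∀ (F : T3Family) (γ : ℝ), F.L = L → 0 < γ → γ ≤ γ₁ →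
        ∃ ψ : ℕ → ℝ, (∀ J, 0 ≤ ψ J) ∧ Tendsto (fun J : ℕ => (J : ℝ) * ψ J) atTop (𝓝 0) ∧
          ∀ (ν : ℕ → (j : ℕ) → Measure (GaugeField (F.P j) 0 (Matrix.specialUnitaryGroup (Fin 2) ℂ))),
            (∀ K, ν K K = T4GenFunBounds.gibbsMeasure (F.P K) ((F.scheme ℰp γ).β K)) →
            (∀ K j, j < K → ν K j = Measure.map (descend F ℰp j) (ν K (j + 1))) →
            ∀ (J K : ℕ) (hJK : J ≤ K) (ρ : GaugeField (F.P J) 0 (Matrix.specialUnitaryGroup (Fin 2) ℂ) → ℝ),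
              (∀ U, PlaqSmall (θBal F.L γ (c * b₀) p₀ J) U → 0 < ρ U) →
              ν K J = (fieldMeasure _ _ _).withDensity (fun U => ENNReal.ofReal (ρ U)) →
              ContinuousOn ρ {U | PlaqSmall (θBal F.L γ (c * b₀) p₀ J) U} →
              (∀ U : GaugeField (F.P J) 0 (Matrix.specialUnitaryGroup (Fin 2) ℂ), PlaqSmall (θBal F.L γ (c * b₀) p₀ J) U →
                  0 < heightDensityCan F γ hJK (histGood F ℰp (θBal F.L γ b₀ p₀) K J) U) →
              ∀ (b b' : PBond (F.P J) 0) (U V W Z : GaugeField (F.P J) 0 (Matrix.specialUnitaryGroup (Fin 2) ℂ)),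
                PlaqSmall (θBal F.L γ (c * b₀) p₀ J) U → PlaqSmall (θBal F.L γ (c * b₀) p₀ J) V →
                PlaqSmall (θBal F.L γ (c * b₀) p₀ J) W → PlaqSmall (θBal F.L γ (c * b₀) p₀ J) Z →
                (∀ e, e ≠ b → U e = V e) → (∀ e, e ≠ b' → U e = W e) → (∀ e, e ≠ b' → V e = Z e) → (∀ e, e ≠ b → W e = Z e) →
                |((fun U => Real.log (ρ U) - Real.log (heightDensityCan F γ hJK (histGood F ℰp (θBal F.L γ b₀ p₀) K J) U)) U -
                    (fun U => Real.log (ρ U) - Real.log (heightDensityCan F γ hJK (histGood F ℰp (θBal F.L γ b₀ p₀) K J) U)) V) -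
                  ((fun U => Real.log (ρ U) - Real.log (heightDensityCan F γ hJK (histGood F ℰp (θBal F.L γ b₀ p₀) K J) U)) W -
                    (fun U => Real.log (ρ U) - Real.log (heightDensityCan F γ hJK (histGood F ℰp (θBal F.L γ b₀ p₀) K J) U)) Z)|
                  ≤ ψ J * Real.exp (-(κ * (b.src.tdist b'.src : ℝ))) :=
  largeFieldFourPtIntCan_of_canInt (canInt_of_enginePackage hE)

end Summit.QuantumFields.YangMills.Theorems.FluctuationComparisonRegPrIntLLargeFieldGasOfEnginePackage

end
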